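import Summits.ResolutionOfSingularities.ResolutionOfSingularities.Theorems.WildConesClassicalRegimesStubMuDropCharTwoOrdPJets

/-!
# Milnor drop in characteristic two (`stub_muDropCharTwoOrdP`) — helper 7/8: Noether

Helper file for the stub `stub_muDropCharTwoOrdP` of crux `ClassicalRegimes`
(stmt-ResolutionOfSingularities-16884, route `WildCones`, line `milnor-descent`): the one-step drop
of the Milnor number `μ = dim_κ κ⟦u₁,…,uₙ⟧/(∂a)` of the cleaned state of `z² = a(u)` under the
point-blow-up dynamics in characteristic two, `n ≥ 3`. The proof works on formal power series:
a hyperbolic pair `u_j u_l` of the quadratic part of `a` is split off by the formal coordinate change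
`u_j ↦ q⁻¹ ∂_l a, u_l ↦ q⁻¹ ∂_j a` (formal inverse function theorem; `∂_j ∂_j = 0` in
characteristic two makes `∂_j ã ∈ (u_l)`, `∂_l ã ∈ (u_j)`), which commutes with the strict
transform; killing `u_j, u_l` descends to `n - 2` variables with the same Milnor algebras. The
leaves: `n ≥ 3` residual variables without hyperbolic pair are not isolated (Case A), `n = 1` is
`μ = ord - 1`, and `n = 2` is Max Noether's inequality `I(∂ₓa, ∂_y a) ≥ m m' + I(strict transforms)`
at the point of the exceptional line plus the multiplicity `≤ 3` of that line in `(∂G)`.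
Sources: G.-M. Greuel, G. Pfister, *The splitting lemma in any characteristic*, J. Algebra 689
(2026) = arXiv:2507.17078, Thm. 3.5 / Cor. 3.7 (the hyperbolic pair; only its linear part is used);
E. Casas-Alvero, *Singularities of Plane Curves*, §3 (Noether's formula); folklore otherwise.

This file: MAX NOETHER'S INEQUALITY at a point of the blow-up: `dim κ⟦x,y⟧/(f', g') + m_f m_g ≤ dim κ⟦x,y⟧/(f, g)` for the transforms `f∘B = x^{m_f} f'`, `g∘B = x^{m_g} g'`; strict transforms and their restriction to the exceptional line; the partials of a state without `x y`-term.
-/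

noncomputable section

-- single-problem summit: the doubled namespace component `ResolutionOfSingularities` is forced
set_option linter.dupNamespace false

open scoped BigOperators Classical

open MvPowerSeries IsLocalRing

open Literature.AlgebraicGeometry.Resolution

namespace Summit.ResolutionOfSingularities.ResolutionOfSingularities.Theorems.WildCones

namespace MuDropCharTwoOrdP

variable {κ : Type} [Field κ]

section Noether

/-- **MAX NOETHER'S INEQUALITY.** Let `f, g ∈ κ⟦x,y⟧` with `ord f ≥ m_f`, `ord g ≥ m_g`, and let
`f∘B = x^{m_f} f'`, `g∘B = x^{m_g} g'` along the blow-up `B = (x, x y)`, where the restriction of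
`f'` to the `y`-axis is non-zero of order `≤ m_f + m_g`. If `(f, g)` and `(f', g')` have finite
colength then `dim κ⟦x,y⟧/(f', g') + m_f m_g ≤ dim κ⟦x,y⟧/(f, g)`. [folklore] -/
theorem noether_inequality {f g f' g' : MvPowerSeries (Fin 2) κ} {mf mg : ℕ}
    (hfm : (mf : ℕ∞) ≤ f.order) (hgm : (mg : ℕ∞) ≤ g.order)
    (hf : subst (![X 0, X 0 * X 1] : Fin 2 → MvPowerSeries (Fin 2) κ) f = X 0 ^ mf * f')
    (hg : subst (![X 0, X 0 * X 1] : Fin 2 → MvPowerSeries (Fin 2) κ) g = X 0 ^ mg * g')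
    (hK : killCompl (⟨fun _ => (1 : Fin 2), fun a b _ => Subsingleton.elim a b⟩ : Fin 1 ↪ Fin 2) f' ≠ 0)
    (hν : (killCompl (⟨fun _ => (1 : Fin 2), fun a b _ => Subsingleton.elim a b⟩ :
      Fin 1 ↪ Fin 2) f').order ≤ ((mf + mg : ℕ) : ℕ∞))
    (hfin : Module.Finite κ (MvPowerSeries (Fin 2) κ ⧸ Ideal.span {f, g}))
    (hfin' : Module.Finite κ (MvPowerSeries (Fin 2) κ ⧸ Ideal.span {f', g'})) :
    Module.finrank κ (MvPowerSeries (Fin 2) κ ⧸ Ideal.span {f', g'}) + mf * mg ≤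
      Module.finrank κ (MvPowerSeries (Fin 2) κ ⧸ Ideal.span {f, g}) := by
  set k := mf + mg with hk
  set m := maximalIdeal (MvPowerSeries (Fin 2) κ) with hm
  set I : Ideal (MvPowerSeries (Fin 2) κ) := Ideal.span {f, g} with hI
  set J' : Ideal (MvPowerSeries (Fin 2) κ) := Ideal.span {f', g'} with hJ'
  set I' : Ideal (MvPowerSeries (Fin 2) κ) := Ideal.span {f} * m ^ mg + Ideal.span {g} * m ^ mf with hI'
  have hB := PlaneGerm.hasSubst_blow (k := κ)
  have hfmem : f ∈ m ^ mf := Literature.RingTheory.MvPowerSeries.Jets.mem_maximalIdeal_pow_of_le_order hfm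
  have hgmem : g ∈ m ^ mg := Literature.RingTheory.MvPowerSeries.Jets.mem_maximalIdeal_pow_of_le_order hgm
  have hfI : f ∈ I := Ideal.subset_span (by simp)
  have hgI : g ∈ I := Ideal.subset_span (by simp)
  have hf'J : f' ∈ J' := Ideal.subset_span (by simp)
  have hg'J : g' ∈ J' := Ideal.subset_span (by simp)
  -- inclusions
  have hI'I : I' ≤ I := by
    rw [hI']
    refine sup_le (Ideal.mul_le_right.trans ?_) (Ideal.mul_le_right.trans ?_)
    · rw [Ideal.span_singleton_le_iff_mem]; exact hfI
    · rw [Ideal.span_singleton_le_iff_mem]; exact hgI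
  have hI'k : I' ≤ m ^ k := by
    rw [hI']
    refine sup_le ?_ ?_
    · rw [hk, pow_add]
      exact Ideal.mul_mono ((Ideal.span_singleton_le_iff_mem _).mpr hfmem) le_rfl
    · rw [hk, add_comm, pow_add]
      exact Ideal.mul_mono ((Ideal.span_singleton_le_iff_mem _).mpr hgmem) le_rfl
  -- finiteness of `S ⧸ I'`
  have hr0 : ∃ r, m ^ r ≤ I := by
    by_cases htop : I = ⊤
    · exact ⟨0, by rw [htop]; exact le_top⟩
    · exact exists_maximalIdeal_pow_le hfin htop
  obtain ⟨r0, hr0⟩ := hr0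
  have hmI' : m ^ (r0 + k) ≤ I' := by
    rw [pow_add]
    refine (Ideal.mul_mono hr0 le_rfl).trans ?_
    rw [hI, Ideal.span_insert, Ideal.sup_mul, hI', Submodule.add_eq_sup]
    refine sup_le_sup ?_ ?_
    · exact Ideal.mul_mono le_rfl (Ideal.pow_le_pow_right (by omega))
    · exact Ideal.mul_mono le_rfl (Ideal.pow_le_pow_right (by omega))
  haveI hfinI' : Module.Finite κ (MvPowerSeries (Fin 2) κ ⧸ I') :=
    finite_quot_mono hmI' (Literature.RingTheory.MvPowerSeries.Jets.finite_quotient_maximalIdeal_pow _)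
  haveI := hfin
  haveI := hfin'
  haveI hfink : Module.Finite κ (MvPowerSeries (Fin 2) κ ⧸ m ^ k) :=
    Literature.RingTheory.MvPowerSeries.Jets.finite_quotient_maximalIdeal_pow _
  -- (a) and (c): colengths along `I' ≤ I` and `I' ≤ m^k`
  haveI : Module.Finite κ (MvPowerSeries (Fin 2) κ ⧸ I'.restrictScalars κ) := hfinI'
  have ha := finrank_quot_eq_add (I'.restrictScalars κ) (I.restrictScalars κ) (fun z hz => hI'I hz)
  have hc := finrank_quot_eq_add (I'.restrictScalars κ) ((m ^ k).restrictScalars κ) (fun z hz => hI'k hz)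
  -- (b): `I/I'` is a quotient of `S/m^{mg} × S/m^{mf}`
  have hb : Module.finrank κ ((I.restrictScalars κ).map (I'.restrictScalars κ).mkQ) ≤
      Module.finrank κ (MvPowerSeries (Fin 2) κ ⧸ m ^ mg) + Module.finrank κ (MvPowerSeries (Fin 2) κ ⧸ m ^ mf) := by
    let ψf : (MvPowerSeries (Fin 2) κ ⧸ m ^ mg) →ₗ[κ] (MvPowerSeries (Fin 2) κ ⧸ I') :=
      Submodule.mapQ ((m ^ mg).restrictScalars κ) (I'.restrictScalars κ) (LinearMap.mulRight κ f) (by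
        intro z hz
        rw [Submodule.mem_comap, LinearMap.mulRight_apply]
        change z * f ∈ I'
        rw [hI', show z * f = f * z from mul_comm z f]
        exact Ideal.mem_sup_left (Ideal.mul_mem_mul (Ideal.mem_span_singleton_self f) hz))
    let ψg : (MvPowerSeries (Fin 2) κ ⧸ m ^ mf) →ₗ[κ] (MvPowerSeries (Fin 2) κ ⧸ I') :=
      Submodule.mapQ ((m ^ mf).restrictScalars κ) (I'.restrictScalars κ) (LinearMap.mulRight κ g) (by
        intro z hz
        rw [Submodule.mem_comap, LinearMap.mulRight_apply]
        change z * g ∈ I'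
        rw [hI', show z * g = g * z from mul_comm z g]
        exact Ideal.mem_sup_right (Ideal.mul_mem_mul (Ideal.mem_span_singleton_self g) hz))
    have hψf : ∀ z, ψf (Submodule.Quotient.mk z) = Submodule.Quotient.mk (z * f) := fun z =>
      Submodule.mapQ_apply _ _ _ z
    have hψg : ∀ z, ψg (Submodule.Quotient.mk z) = Submodule.Quotient.mk (z * g) := fun z =>
      Submodule.mapQ_apply _ _ _ z
    haveI : Module.Finite κ (MvPowerSeries (Fin 2) κ ⧸ m ^ mg) :=
      Literature.RingTheory.MvPowerSeries.Jets.finite_quotient_maximalIdeal_pow _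
    haveI : Module.Finite κ (MvPowerSeries (Fin 2) κ ⧸ m ^ mf) :=
      Literature.RingTheory.MvPowerSeries.Jets.finite_quotient_maximalIdeal_pow _
    have hle : (I.restrictScalars κ).map (I'.restrictScalars κ).mkQ ≤ LinearMap.range (ψf.coprod ψg) := by
      rintro _ ⟨z, hz, rfl⟩
      change z ∈ I at hz
      rw [hI, Ideal.mem_span_pair] at hz
      obtain ⟨α, β, rfl⟩ := hz
      refine ⟨(Submodule.Quotient.mk α, Submodule.Quotient.mk β), ?_⟩
      rw [LinearMap.coprod_apply, hψf, hψg, Submodule.mkQ_apply, ← Submodule.Quotient.mk_add]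
      rfl
    calc Module.finrank κ ((I.restrictScalars κ).map (I'.restrictScalars κ).mkQ)
        ≤ Module.finrank κ (LinearMap.range (ψf.coprod ψg)) := Submodule.finrank_mono hle
      _ ≤ Module.finrank κ ((MvPowerSeries (Fin 2) κ ⧸ m ^ mg) × (MvPowerSeries (Fin 2) κ ⧸ m ^ mf)) :=
          LinearMap.finrank_range_le _
      _ = _ := Module.finrank_prod
  -- (d): `S/J'` is a quotient of `m^k / I'`
  have hd : Module.finrank κ (MvPowerSeries (Fin 2) κ ⧸ J') ≤
      Module.finrank κ (((m ^ k).restrictScalars κ).map (I'.restrictScalars κ).mkQ) := by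
    -- the shift `F ↦ F / x^k` (on multiples of `x^k`)
    let Dk : MvPowerSeries (Fin 2) κ →ₗ[κ] MvPowerSeries (Fin 2) κ :=
      { toFun := fun F => fun e => coeff (e + Finsupp.single 0 k) F
        map_add' := fun F G => by ext e; simp only [map_add]; rfl
        map_smul' := fun c F => by ext e; simp only [map_smul, RingHom.id_apply]; rfl }
    have hDk : ∀ F e, coeff e (Dk F) = coeff (e + Finsupp.single 0 k) F := fun F e => rfl
    have hDkX : ∀ F, Dk (X 0 ^ k * F) = F := fun F => by
      ext e
      rw [hDk, X_pow_eq, coeff_monomial_mul, if_pos (by simp), one_mul, add_tsub_cancel_right]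
    let Θ : MvPowerSeries (Fin 2) κ →ₗ[κ] (MvPowerSeries (Fin 2) κ ⧸ J') :=
      (J'.restrictScalars κ).mkQ ∘ₗ Dk ∘ₗ (substAlgHom hB).toLinearMap
    have hΘ : ∀ z, Θ z = Submodule.Quotient.mk (Dk (subst ![X 0, X 0 * X 1] z)) := fun z => by
      simp only [Θ, LinearMap.comp_apply, AlgHom.toLinearMap_apply, substAlgHom_apply]
      rfl
    -- `Θ` kills `I'`
    have hkill : I'.restrictScalars κ ≤ LinearMap.ker Θ := by
      intro z hz
      change z ∈ I' at hz
      rw [LinearMap.mem_ker, hΘ, Submodule.Quotient.mk_eq_zero]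
      change Dk (subst ![X 0, X 0 * X 1] z) ∈ J'
      rw [hI', Submodule.add_eq_sup, Submodule.mem_sup] at hz
      obtain ⟨z₁, hz₁, z₂, hz₂, rfl⟩ := hz
      rw [Ideal.mem_span_singleton_mul] at hz₁ hz₂
      obtain ⟨p₁, hp₁, rfl⟩ := hz₁
      obtain ⟨p₂, hp₂, rfl⟩ := hz₂
      obtain ⟨q₁, hq₁⟩ := PlaneGerm.X_pow_dvd_subst hB (fun i => by fin_cases i <;> simp) (m := mg)
        (Literature.RingTheory.MvPowerSeries.Jets.le_order_of_mem_maximalIdeal_pow hp₁)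
      obtain ⟨q₂, hq₂⟩ := PlaneGerm.X_pow_dvd_subst hB (fun i => by fin_cases i <;> simp) (m := mf)
        (Literature.RingTheory.MvPowerSeries.Jets.le_order_of_mem_maximalIdeal_pow hp₂)
      rw [subst_add hB, subst_mul hB, subst_mul hB, hf, hg, hq₁, hq₂,
        show X 0 ^ mf * f' * (X 0 ^ mg * q₁) + X 0 ^ mg * g' * (X 0 ^ mf * q₂) =
          X 0 ^ k * (f' * q₁ + g' * q₂) by rw [hk, pow_add]; ring, hDkX]
      exact J'.add_mem (J'.mul_mem_right _ hf'J) (J'.mul_mem_right _ hg'J)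
    let Θ' : (MvPowerSeries (Fin 2) κ ⧸ I') →ₗ[κ] (MvPowerSeries (Fin 2) κ ⧸ J') :=
      (I'.restrictScalars κ).liftQ Θ hkill
    have hΘ' : ∀ z, Θ' (Submodule.Quotient.mk z) = Θ z := fun z => Submodule.liftQ_apply _ _ z
    -- surjectivity on `m^k / I'`
    obtain ⟨u, f₁, hu, hf'dec⟩ := exists_axis_decomposition hK
    have hνk : (killCompl (⟨fun _ => (1 : Fin 2), fun a b _ => Subsingleton.elim a b⟩ :
        Fin 1 ↪ Fin 2) f').order.toNat ≤ k := by
      have hfin'' := (ne_zero_iff_order_finite.mp hK)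
      rw [← hfin''] at hν
      exact_mod_cast hν
    have hr : ∃ r, (X 0 : MvPowerSeries (Fin 2) κ) ^ r ∈ J' := by
      by_cases htop : J' = ⊤
      · exact ⟨0, by rw [htop]; exact Submodule.mem_top⟩
      · obtain ⟨r, hr⟩ := exists_maximalIdeal_pow_le hfin' htop
        exact ⟨r, hr (Ideal.pow_mem_pow (X_mem_maximalIdeal κ (Fin 2) (0 : Fin 2)) r)⟩
    obtain ⟨r, hr⟩ := hr
    have hsurj : Function.Surjective (Θ' ∘ₗ (((m ^ k).restrictScalars κ).map (I'.restrictScalars κ).mkQ).subtype) := by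
      intro y
      obtain ⟨y, rfl⟩ := Submodule.Quotient.mk_surjective _ y
      obtain ⟨μ, c, t, hμ, hy⟩ := exists_reduction hu hνk hf'dec r y
      obtain ⟨h, hhm, hh⟩ := exists_blow_preimage k hμ
      refine ⟨⟨Submodule.Quotient.mk h, ⟨h, hhm, rfl⟩⟩, ?_⟩
      rw [LinearMap.comp_apply]
      change Θ' (Submodule.Quotient.mk h) = _
      rw [hΘ', hΘ, Submodule.Quotient.eq]
      change Dk (subst ![X 0, X 0 * X 1] h) - y ∈ J'
      have : Dk (subst ![X 0, X 0 * X 1] h) = μ := by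
        ext e; rw [hDk, hh]
      rw [this, hy, show μ - (μ + c * f' + X 0 ^ r * t) = -(c * f' + X 0 ^ r * t) by ring]
      exact J'.neg_mem (J'.add_mem (J'.mul_mem_left _ hf'J) (J'.mul_mem_right _ hr))
    have := LinearMap.finrank_range_le (Θ' ∘ₗ (((m ^ k).restrictScalars κ).map (I'.restrictScalars κ).mkQ).subtype)
    rwa [LinearMap.range_eq_top.mpr hsurj, finrank_top] at this
  -- (e): combine with the jet dimensions
  have h2k := two_mul_finrank_quot_maximalIdeal_pow (κ := κ) k
  have h2f := two_mul_finrank_quot_maximalIdeal_pow (κ := κ) mf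
  have h2g := two_mul_finrank_quot_maximalIdeal_pow (κ := κ) mg
  have hkk : k * (k + 1) = mf * (mf + 1) + mg * (mg + 1) + 2 * (mf * mg) := by rw [hk]; ring
  change Module.finrank κ (MvPowerSeries (Fin 2) κ ⧸ I') = Module.finrank κ (MvPowerSeries (Fin 2) κ ⧸ I) + _ at ha
  change Module.finrank κ (MvPowerSeries (Fin 2) κ ⧸ I') = Module.finrank κ (MvPowerSeries (Fin 2) κ ⧸ m ^ k) + _ at hc
  nlinarith [ha, hb, hc, hd, h2k, h2f, h2g, hkk]

end Noether

/-! ## The surface leaf: two residual variables -/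

section Surface

/-- The blow-up family at `n = 2`, `i = 0`, `τ = 0` is `(x, x y)`. [folklore] -/
theorem blowFam_two_zero :
    (fun s => if s = (0 : Fin 2) then (X 0 : MvPowerSeries (Fin 2) κ)
      else X 0 * (X s + C ((0 : Fin 2 → κ) s))) = ![X 0, X 0 * X 1] := by
  funext s
  fin_cases s <;> simp

/-- The blow-up family at `n = 2`, `i = 0` is the chart of slope `τ 1`. [folklore] -/
theorem blowFam_two_eq_dirChart (τ : Fin 2 → κ) :
    (fun s => if s = (0 : Fin 2) then (X 0 : MvPowerSeries (Fin 2) κ)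
      else X 0 * (X s + C (τ s))) = PlaneGerm.dirChart (τ 1) := by
  funext s
  fin_cases s
  · simp
  · simp [add_comm]

/-- STRICT TRANSFORMS AND THE AXIS: for `f ≠ 0` of order `m`, `f∘B = x^m f'` with `f'(0, y) ≠ 0`
of `y`-order `≤ m`. [folklore] -/
theorem exists_strict_transform {f : MvPowerSeries (Fin 2) κ} (hf : f ≠ 0) :
    ∃ f' : MvPowerSeries (Fin 2) κ,
      subst (![X 0, X 0 * X 1] : Fin 2 → MvPowerSeries (Fin 2) κ) f = X 0 ^ f.order.toNat * f' ∧
      killCompl (⟨fun _ => (1 : Fin 2), fun a b _ => Subsingleton.elim a b⟩ : Fin 1 ↪ Fin 2) f' ≠ 0 ∧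
      (killCompl (⟨fun _ => (1 : Fin 2), fun a b _ => Subsingleton.elim a b⟩ : Fin 1 ↪ Fin 2) f').order ≤
        (f.order.toNat : ℕ∞) := by
  have finTwo_eq : ∀ e : Fin 2 →₀ ℕ, e = Finsupp.single 0 (e 0) + Finsupp.single 1 (e 1) := fun e =>
    Finsupp.ext fun s => by fin_cases s <;> simp
  have finTwo_degree : ∀ e : Fin 2 →₀ ℕ, e.degree = e 0 + e 1 := fun e => by
    rw [Finsupp.degree_eq_sum, Fin.sum_univ_two]
  set mf := f.order.toNat with hmf
  have hord : (mf : ℕ∞) = f.order := ne_zero_iff_order_finite.mp hf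
  obtain ⟨f', hf'⟩ := PlaneGerm.X_pow_dvd_subst PlaneGerm.hasSubst_blow (fun i => by fin_cases i <;> simp)
    (b := f) (m := mf) hord.le
  obtain ⟨E, hE, hdeg⟩ := exists_coeff_ne_zero_and_order hord
  rw [finTwo_degree] at hdeg
  have hdeg' : E 0 + E 1 = mf := by
    have := hdeg.trans hord.symm
    exact_mod_cast this
  have hcoef : coeff (Finsupp.single 0 (E 1)) (killCompl (⟨fun _ => (1 : Fin 2), fun a b _ =>
      Subsingleton.elim a b⟩ : Fin 1 ↪ Fin 2) f') = coeff E f := by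
    rw [coeff_killCompl_axis]
    have h1 : coeff (Finsupp.single 0 mf + Finsupp.single 1 (E 1)) (X 0 ^ mf * f') =
        coeff (Finsupp.single 1 (E 1)) f' := by
      rw [X_pow_eq, coeff_monomial_mul, if_pos (by simp), one_mul, add_tsub_cancel_left]
    rw [← h1, ← hf', coeff_subst_blow', (finTwo_pair_apply _ _).1, (finTwo_pair_apply _ _).2,
      if_pos (by omega), show mf - E 1 = E 0 by omega, ← finTwo_eq E]
  refine ⟨f', hf', fun h0 => ?_, ?_⟩
  · apply hE; rw [← hcoef, h0, map_zero]
  · refine (order_le (d := Finsupp.single 0 (E 1)) (by rw [hcoef]; exact hE)).trans ?_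
    rw [Finsupp.degree_single]
    exact_mod_cast (show E 1 ≤ mf by omega)

/-- The partials of a series of order `≥ 2` without `x y`-term have order `≥ 2` (char. two).
[folklore] -/
theorem two_le_order_pderiv_two [CharP κ 2] {a : MvPowerSeries (Fin 2) κ} (ha : 2 ≤ a.order)
    (hnopair : coeff (Finsupp.single 0 1 + Finsupp.single 1 1) a = 0) (s : Fin 2) :
    2 ≤ (MvPowerSeries.pderiv s a).order := by
  have ha' := (FormalCoordChange.two_le_order_iff a).mp ha
  rw [FormalCoordChange.two_le_order_iff]
  refine ⟨by rw [constantCoeff_pderiv]; exact ha'.2 s, fun t => ?_⟩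
  rw [coeff_single_pderiv]
  by_cases hts : t = s
  · rw [hts, Finsupp.single_eq_same, Nat.cast_one, CharTwo.add_self_eq_zero, zero_mul]
  · have : coeff (Finsupp.single t 1 + Finsupp.single s 1) a = 0 := by
      fin_cases s <;> fin_cases t
      · exact absurd rfl hts
      · rw [add_comm]; exact hnopair
      · exact hnopair
      · exact absurd rfl hts
    rw [this, mul_zero]

end Surface

end MuDropCharTwoOrdP

end Summit.ResolutionOfSingularities.ResolutionOfSingularities.Theorems.WildCones

end
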